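import Literature.Analysis.Complex.IsolatedSingularityDichotomy
import Literature.AnabelianGeometry.AbsoluteAnabelian.AutHolomorphicSpacesTransportProofs
import Mathlib.Topology.Compactness.Compact
import HarnessLib

/-!
# Biholomorphic automorphisms of the thrice-punctured sphere, I: behaviour at the punctures

Classical: a biholomorphic self-map of `ℂ ∖ {0, 1}` (the Riemann sphere punctured at `0, 1, ∞`)
extends to a Möbius transformation permuting `{0, 1, ∞}`; hence `Aut(ℂ ∖ {0,1})` is the anharmonic
group of order `6` (J. B. Conway, *Functions of One Complex Variable I* (1978), Ch. V §1 (isolated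
singularities: Thm. 1.21 Casorati–Weierstrass, Def. 1.3) with Ch. III §3 (Möbius transformations,
Prop. 3.8 ff.); the statement in this form: R. Remmert, *Classical Topics in Complex Function Theory*,
Ch. 10; it is also the `N = 3` case of the automorphism group of a punctured sphere).  This first file
establishes, for `φ ∈ Aut^hol(ℂ ∖ {0,1})` — typed over abc-iut-L4's `holAut` ([AbsTopIII] Def. 2.1 (i),
the group of biholomorphic self-homeomorphisms of an open subset of a Riemann surface) — and an
ambient representative `F : ℂ → ℂ` of `φ`:

* `ThricePunctured.eventually_le_norm_sub` — `F` omits a disc near each of the three punctures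
  (injectivity + openness of `φ`);
* `ThricePunctured.end_trichotomy` — at each puncture `e ∈ {0, 1, ∞}` (filters `𝓝[≠] 0`, `𝓝[≠] 1`,
  `cocompact ℂ`), `F` tends to one of the three punctures (Casorati–Weierstrass contrapositive
  `IsolatedSingularityDichotomy` + a compactness argument excluding finite limits inside `ℂ ∖ {0,1}`);
* `ThricePunctured.end_injective` — distinct punctures go to distinct punctures (apply the trichotomy
  to `φ⁻¹`).

The classification itself (`φ` is one of the six Möbius maps `z, 1-z, 1/z, 1/(1-z), 1-1/z, z/(z-1)`) is
in `ThricePuncturedSphereAutomorphisms.lean`.  No definitions: the domain is any `U : Opens ℂ` with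
`(U : Set ℂ) = {z | z ≠ 0 ∧ z ≠ 1}`, and `F` is any function agreeing with `φ` on `U`.
[cite: Conway1978, Ch. V Thm. 1.21 and Def. 1.3]
-/

noncomputable section

namespace Literature.Analysis.Complex

namespace ThricePunctured

open Filter Topology Metric Bornology Set Function
open scoped Manifold ContDiff
open _root_.TopologicalSpace (Opens)
open Literature.AnabelianGeometry.AbsoluteAnabelian

variable {U : Opens ℂ} (hU : (U : Set ℂ) = {z | z ≠ 0 ∧ z ≠ 1})

/-! ### The domain `ℂ ∖ {0,1}` and the three puncture filters -/

include hU in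
/-- Membership in `U = ℂ ∖ {0,1}`. [cite: Conway1978, Ch. V Def. 1.3] -/
theorem mem_iff {z : ℂ} : z ∈ U ↔ z ≠ 0 ∧ z ≠ 1 := by
  change z ∈ (U : Set ℂ) ↔ _
  rw [hU]; rfl

include hU in
/-- Near `0` (punctured) every point lies in `U`. [cite: Conway1978, Ch. V Def. 1.3] -/
theorem eventually_mem_nhdsNE_zero : ∀ᶠ z in 𝓝[≠] (0 : ℂ), z ∈ U := by
  have h : ball (0 : ℂ) 1 ∩ {z | z ≠ 0} ⊆ (U : Set ℂ) := by
    rintro z ⟨hz, hz0⟩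
    rw [hU]
    refine ⟨hz0, fun h1 => ?_⟩
    rw [h1, mem_ball, dist_zero_right, norm_one] at hz
    exact lt_irrefl _ hz
  exact mem_of_superset (inter_mem_nhdsWithin _ (ball_mem_nhds _ one_pos)) (by
    rintro z ⟨hz0, hz⟩; exact h ⟨hz, hz0⟩)

include hU in
/-- Near `1` (punctured) every point lies in `U`. [cite: Conway1978, Ch. V Def. 1.3] -/
theorem eventually_mem_nhdsNE_one : ∀ᶠ z in 𝓝[≠] (1 : ℂ), z ∈ U := by
  have h : ball (1 : ℂ) 1 ∩ {z | z ≠ 1} ⊆ (U : Set ℂ) := by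
    rintro z ⟨hz, hz1⟩
    rw [hU]
    refine ⟨fun h0 => ?_, hz1⟩
    rw [h0, mem_ball, dist_comm, dist_zero_right, norm_one] at hz
    exact lt_irrefl _ hz
  exact mem_of_superset (inter_mem_nhdsWithin _ (ball_mem_nhds _ one_pos)) (by
    rintro z ⟨hz1, hz⟩; exact h ⟨hz, hz1⟩)

include hU in
/-- Near `∞` every point lies in `U`. [cite: Conway1978, Ch. V Def. 1.3] -/
theorem eventually_mem_cocompact : ∀ᶠ z in cocompact ℂ, z ∈ U := by
  have h := (tendsto_norm_cocompact_atTop (E := ℂ)).eventually (eventually_gt_atTop (1 : ℝ))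
  refine h.mono fun z hz => ?_
  rw [← SetLike.mem_coe, hU]
  constructor
  · rintro rfl; rw [norm_zero] at hz; linarith
  · rintro rfl; rw [norm_one] at hz; linarith

/-- The three puncture filters of `ℂ ∖ {0,1}`: `𝓝[≠] 0`, `𝓝[≠] 1` and `cocompact ℂ` (the punctured
neighbourhood filter of `∞`).  Membership in this three-element set of filters, spelled out (no
definition is introduced). [cite: Conway1978, Ch. V Def. 1.3] -/
theorem mem_ends_iff {l : Filter ℂ} :
    l ∈ ({𝓝[≠] (0 : ℂ), 𝓝[≠] (1 : ℂ), cocompact ℂ} : Set (Filter ℂ)) ↔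
      l = 𝓝[≠] 0 ∨ l = 𝓝[≠] 1 ∨ l = cocompact ℂ := by
  simp only [Set.mem_insert_iff, Set.mem_singleton_iff]

/-- Each puncture filter is non-trivial. [cite: Conway1978, Ch. V Def. 1.3] -/
theorem neBot_of_mem_ends {l : Filter ℂ}
    (hl : l ∈ ({𝓝[≠] (0 : ℂ), 𝓝[≠] (1 : ℂ), cocompact ℂ} : Set (Filter ℂ))) : l.NeBot := by
  rcases mem_ends_iff.mp hl with rfl | rfl | rfl
  · exact NormedField.nhdsNE_neBot 0
  · exact NormedField.nhdsNE_neBot 1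
  · infer_instance

include hU in
/-- Along each puncture filter, points eventually lie in `U`. [cite: Conway1978, Ch. V Def. 1.3] -/
theorem eventually_mem_of_mem_ends {l : Filter ℂ}
    (hl : l ∈ ({𝓝[≠] (0 : ℂ), 𝓝[≠] (1 : ℂ), cocompact ℂ} : Set (Filter ℂ))) : ∀ᶠ z in l, z ∈ U := by
  rcases mem_ends_iff.mp hl with rfl | rfl | rfl
  · exact eventually_mem_nhdsNE_zero hU
  · exact eventually_mem_nhdsNE_one hU
  · exact eventually_mem_cocompact hU

/-- Along each puncture filter, points eventually leave any compact subset of `ℂ` contained in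
`ℂ ∖ {0,1}` (the puncture filters are the "ends" of `U`). [cite: Conway1978, Ch. V Def. 1.3] -/
theorem eventually_not_mem_of_isCompact {l : Filter ℂ}
    (hl : l ∈ ({𝓝[≠] (0 : ℂ), 𝓝[≠] (1 : ℂ), cocompact ℂ} : Set (Filter ℂ))) {A : Set ℂ}
    (hA : IsCompact A) (h0 : (0 : ℂ) ∉ A) (h1 : (1 : ℂ) ∉ A) : ∀ᶠ z in l, z ∉ A := by
  rcases mem_ends_iff.mp hl with rfl | rfl | rfl
  · exact mem_nhdsWithin_of_mem_nhds (hA.isClosed.isOpen_compl.mem_nhds h0)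
  · exact mem_nhdsWithin_of_mem_nhds (hA.isClosed.isOpen_compl.mem_nhds h1)
  · exact hA.compl_mem_cocompact

/-- Distinct puncture filters are disjoint (distinct punctures have disjoint punctured neighbourhoods;
a punctured neighbourhood of a finite puncture is bounded). [cite: Conway1978, Ch. V Def. 1.3] -/
theorem disjoint_of_mem_ends_of_ne {l l' : Filter ℂ}
    (hl : l ∈ ({𝓝[≠] (0 : ℂ), 𝓝[≠] (1 : ℂ), cocompact ℂ} : Set (Filter ℂ)))
    (hl' : l' ∈ ({𝓝[≠] (0 : ℂ), 𝓝[≠] (1 : ℂ), cocompact ℂ} : Set (Filter ℂ))) (hne : l ≠ l') :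
    Disjoint l l' := by
  have hK0 : IsCompact (closedBall (0 : ℂ) (1/3)) := isCompact_closedBall _ _
  have hK1 : IsCompact (closedBall (1 : ℂ) (1/3)) := isCompact_closedBall _ _
  have m0 : closedBall (0 : ℂ) (1/3) ∈ 𝓝[≠] (0 : ℂ) :=
    mem_nhdsWithin_of_mem_nhds (closedBall_mem_nhds _ (by norm_num))
  have m1 : closedBall (1 : ℂ) (1/3) ∈ 𝓝[≠] (1 : ℂ) :=
    mem_nhdsWithin_of_mem_nhds (closedBall_mem_nhds _ (by norm_num))
  have d01 : Disjoint (closedBall (0 : ℂ) (1/3)) (closedBall (1 : ℂ) (1/3)) := by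
    rw [Set.disjoint_left]
    intro z hz hz'
    rw [mem_closedBall, dist_zero_right] at hz
    rw [mem_closedBall, dist_eq_norm] at hz'
    have h := norm_add_le (z - 1) (-z)
    have e1 : z - 1 + -z = -1 := by ring
    rw [e1, norm_neg, norm_one, norm_neg] at h
    linarith
  have key : ∀ {A B : Set ℂ}, A ∈ l → B ∈ l' → Disjoint A B → Disjoint l l' :=
    fun hA hB hAB => Filter.disjoint_iff.mpr ⟨_, hA, _, hB, hAB⟩
  rcases mem_ends_iff.mp hl with rfl | rfl | rfl <;> rcases mem_ends_iff.mp hl' with rfl | rfl | rfl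
  · exact (hne rfl).elim
  · exact key m0 m1 d01
  · exact key m0 hK0.compl_mem_cocompact disjoint_compl_right
  · exact key m1 m0 d01.symm
  · exact (hne rfl).elim
  · exact key m1 hK1.compl_mem_cocompact disjoint_compl_right
  · exact key hK0.compl_mem_cocompact m0 disjoint_compl_left
  · exact key hK1.compl_mem_cocompact m1 disjoint_compl_left
  · exact (hne rfl).elim

/-- Two puncture filters that are comparable are equal. [cite: Conway1978, Ch. V Def. 1.3] -/
theorem eq_of_mem_ends_of_le {l l' : Filter ℂ}
    (hl : l ∈ ({𝓝[≠] (0 : ℂ), 𝓝[≠] (1 : ℂ), cocompact ℂ} : Set (Filter ℂ)))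
    (hl' : l' ∈ ({𝓝[≠] (0 : ℂ), 𝓝[≠] (1 : ℂ), cocompact ℂ} : Set (Filter ℂ))) (h : l ≤ l') :
    l = l' := by
  by_contra hne
  haveI := neBot_of_mem_ends hl
  have hd := disjoint_of_mem_ends_of_ne hl hl' hne
  have : l = ⊥ := by
    have h2 : l ⊓ l' = l := inf_eq_left.mpr h
    rw [← h2]; exact hd.eq_bot
  exact (neBot_of_mem_ends hl).ne this

/-! ### The ambient representative of an automorphism -/

section Aut

variable {φ : U ≃ₜ U} {F : ℂ → ℂ}

/-- `φ` maps into `U`: `F z ≠ 0, 1` for `z ∈ U`. [cite: Conway1978, Ch. V Def. 1.3] -/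
theorem apply_mem (hF : ∀ x : U, (φ x : ℂ) = F x) {z : ℂ} (hz : z ∈ U) : F z ∈ U := by
  rw [← hF ⟨z, hz⟩]; exact (φ ⟨z, hz⟩).2

/-- `F` is injective on `U`. [cite: Conway1978, Ch. V Def. 1.3] -/
theorem injOn (hF : ∀ x : U, (φ x : ℂ) = F x) : InjOn F U := by
  intro z hz z' hz' h
  have : φ ⟨z, hz⟩ = φ ⟨z', hz'⟩ := Subtype.ext (by rw [hF, hF]; exact h)
  exact congrArg Subtype.val (φ.injective this)

/-- The ambient representative of the inverse undoes `F` on `U`. [cite: Conway1978, Ch. V Def. 1.3] -/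
theorem symm_apply_apply (hF : ∀ x : U, (φ x : ℂ) = F x) {F' : ℂ → ℂ}
    (hF' : ∀ x : U, (φ.symm x : ℂ) = F' x) {z : ℂ} (hz : z ∈ U) : F' (F z) = z := by
  have h1 : F z = (φ ⟨z, hz⟩ : ℂ) := (hF ⟨z, hz⟩).symm
  have h2 : F' (φ ⟨z, hz⟩ : ℂ) = (φ.symm (φ ⟨z, hz⟩) : ℂ) := (hF' (φ ⟨z, hz⟩)).symm
  rw [h1, h2, φ.symm_apply_apply]

/-- A biholomorphic `φ` has a complex-differentiable ambient representative on `U`.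
[cite: Conway1978, Ch. V Def. 1.3] -/
theorem differentiableAt (hφ : φ ∈ holAut U) (hF : ∀ x : U, (φ x : ℂ) = F x) {z : ℂ}
    (hz : z ∈ U) : DifferentiableAt ℂ F z := by
  have h := (mem_holAut_iff φ).mp hφ
  have h1 := h.1 ⟨z, hz⟩
  rw [mdifferentiableAt_opens_iff hF ⟨z, hz⟩] at h1
  exact mdifferentiableAt_iff_differentiableAt.mp h1

include hU in
/-- Along each puncture filter, `F` is eventually complex differentiable.
[cite: Conway1978, Ch. V Def. 1.3] -/
theorem eventually_differentiableAt (hφ : φ ∈ holAut U) (hF : ∀ x : U, (φ x : ℂ) = F x)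
    {l : Filter ℂ} (hl : l ∈ ({𝓝[≠] (0 : ℂ), 𝓝[≠] (1 : ℂ), cocompact ℂ} : Set (Filter ℂ))) :
    ∀ᶠ z in l, DifferentiableAt ℂ F z :=
  (eventually_mem_of_mem_ends hU hl).mono fun _ hz => differentiableAt hφ hF hz

include hU in
/-- **`F` omits a disc away from a compact part of `U`**: there are `w` and `δ > 0` such that
`δ ≤ ‖F z - w‖` for all `z ∈ U` outside the disc `B(-1, 1/2)` (whose image under the open injective
map `φ` contains a disc `B(w, δ)`). [cite: Conway1978, Ch. V Thm. 1.21 and Def. 1.3] -/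
theorem exists_le_norm_sub (hF : ∀ x : U, (φ x : ℂ) = F x) :
    ∃ (w : ℂ) (δ : ℝ), 0 < δ ∧ ∀ z ∈ U, z ∉ ball (-1 : ℂ) (1/2) → δ ≤ ‖F z - w‖ := by
  -- the disc `B(-1, 1/2)` lies in `U`
  have hB : ball (-1 : ℂ) (1/2) ⊆ (U : Set ℂ) := by
    intro z hz
    rw [hU]
    rw [mem_ball] at hz
    constructor
    · rintro rfl
      norm_num [dist_eq_norm] at hz
    · rintro rfl
      norm_num [dist_eq_norm] at hz
  -- its preimage in the subtype is open, and so is the image under `φ`, and under `val`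
  set B' : Set U := {x | (x : ℂ) ∈ ball (-1 : ℂ) (1/2)} with hB'
  have hB'o : IsOpen B' := isOpen_ball.preimage continuous_subtype_val
  have hVo : IsOpen (Subtype.val '' (φ '' B') : Set ℂ) :=
    U.2.isOpenMap_subtype_val _ (φ.isOpenMap _ hB'o)
  have hm1 : (-1 : ℂ) ∈ U := hB (mem_ball_self (by norm_num))
  have hw : F (-1) ∈ (Subtype.val '' (φ '' B') : Set ℂ) :=
    ⟨φ ⟨-1, hm1⟩, ⟨⟨-1, hm1⟩, mem_ball_self (by norm_num), rfl⟩, hF _⟩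
  obtain ⟨δ, hδ, hδV⟩ := Metric.isOpen_iff.mp hVo _ hw
  refine ⟨F (-1), δ, hδ, fun z hz hzB => ?_⟩
  by_contra hlt
  rw [not_le] at hlt
  have hmem : F z ∈ ball (F (-1)) δ := by rwa [mem_ball, dist_eq_norm]
  obtain ⟨y, ⟨x, hxB, rfl⟩, hy⟩ := hδV hmem
  -- `φ x = φ ⟨z, hz⟩`, hence `x = z ∈ B(-1, 1/2)`: contradiction
  have hφx : φ x = φ ⟨z, hz⟩ := Subtype.ext (by rw [hy, hF])
  have hxz : x = ⟨z, hz⟩ := φ.injective hφx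
  exact hzB (by have h' := hxB; rw [hxz] at h'; exact h')

include hU in
/-- Along each puncture filter, `F` eventually stays at distance `≥ δ` from `w` (for the `w, δ` of
`exists_le_norm_sub`). [cite: Conway1978, Ch. V Thm. 1.21 and Def. 1.3] -/
theorem eventually_le_norm_sub (hF : ∀ x : U, (φ x : ℂ) = F x) {l : Filter ℂ}
    (hl : l ∈ ({𝓝[≠] (0 : ℂ), 𝓝[≠] (1 : ℂ), cocompact ℂ} : Set (Filter ℂ))) :
    ∃ (w : ℂ) (δ : ℝ), 0 < δ ∧ ∀ᶠ z in l, δ ≤ ‖F z - w‖ := by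
  obtain ⟨w, δ, hδ, h⟩ := exists_le_norm_sub hU hF
  refine ⟨w, δ, hδ, ?_⟩
  have hK : IsCompact (closedBall (-1 : ℂ) (1/2)) := isCompact_closedBall _ _
  have h0 : (0 : ℂ) ∉ closedBall (-1 : ℂ) (1/2) := by
    rw [mem_closedBall]; norm_num [dist_eq_norm]
  have h1 : (1 : ℂ) ∉ closedBall (-1 : ℂ) (1/2) := by
    rw [mem_closedBall]; norm_num [dist_eq_norm]
  filter_upwards [eventually_mem_of_mem_ends hU hl, eventually_not_mem_of_isCompact hl hK h0 h1]
    with z hz hzK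
  exact h z hz fun hb => hzK (ball_subset_closedBall hb)

include hU in
/-- **No finite limit inside `U` at a puncture.**  If `F → L` along a puncture filter then
`L ∉ U`: otherwise the points near the puncture would lie in the compact set
`φ⁻¹(closed disc around L)` of `U`. [cite: Conway1978, Ch. V Def. 1.3] -/
theorem not_mem_of_tendsto_nhds (hF : ∀ x : U, (φ x : ℂ) = F x) {l : Filter ℂ}
    (hl : l ∈ ({𝓝[≠] (0 : ℂ), 𝓝[≠] (1 : ℂ), cocompact ℂ} : Set (Filter ℂ))) {L : ℂ}
    (hL : Tendsto F l (𝓝 L)) : L ∉ U := by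
  intro hLU
  haveI := neBot_of_mem_ends hl
  -- a closed disc around `L` inside `U`
  obtain ⟨ε, hε, hεU⟩ := Metric.isOpen_iff.mp U.2 L hLU
  set D : Set ℂ := closedBall L (ε/2) with hD
  have hDU : D ⊆ (U : Set ℂ) := (closedBall_subset_ball (by linarith)).trans hεU
  -- its preimage under `φ`, pushed to `ℂ`, is compact and misses `0, 1`
  set S : Set U := {x | (x : ℂ) ∈ D} with hS
  have hSD : Subtype.val '' S = D := by
    ext z; constructor
    · rintro ⟨x, hx, rfl⟩; exact hx
    · intro hz; exact ⟨⟨z, hDU hz⟩, hz, rfl⟩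
  have hSc : IsCompact S :=
    (Topology.IsInducing.subtypeVal.isCompact_iff).mpr (hSD ▸ isCompact_closedBall L (ε/2))
  set A : Set ℂ := Subtype.val '' (φ.symm '' S) with hA
  have hAc : IsCompact A := (hSc.image φ.symm.continuous).image continuous_subtype_val
  have hAU : A ⊆ (U : Set ℂ) := by rintro _ ⟨x, _, rfl⟩; exact x.2
  have h0 : (0 : ℂ) ∉ A := fun h => ((mem_iff hU).mp (hAU h)).1 rfl
  have h1 : (1 : ℂ) ∉ A := fun h => ((mem_iff hU).mp (hAU h)).2 rfl
  -- eventually `z ∈ A` (as `F z ∈ D`) and eventually `z ∉ A`: contradiction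
  have hev : ∀ᶠ z in l, z ∈ A := by
    filter_upwards [eventually_mem_of_mem_ends hU hl, hL (closedBall_mem_nhds L (half_pos hε))]
      with z hz hzD
    refine ⟨φ.symm (φ ⟨z, hz⟩), ⟨φ ⟨z, hz⟩, ?_, rfl⟩, by rw [φ.symm_apply_apply]⟩
    change (φ ⟨z, hz⟩ : ℂ) ∈ D
    rw [hF]; exact hzD
  obtain ⟨z, hz1, hz2⟩ := (hev.and (eventually_not_mem_of_isCompact hl hAc h0 h1)).exists
  exact hz2 hz1

include hU in
/-- **Trichotomy at a puncture.**  For a biholomorphic self-map `φ` of `ℂ ∖ {0,1}` with ambient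
representative `F` and a puncture filter `l ∈ {𝓝[≠] 0, 𝓝[≠] 1, cocompact ℂ}`: `F` tends along `l` to
one of the punctures, i.e. `Tendsto F l l'` for some puncture filter `l'` (targets in the punctured /
within-`U` form, so that such statements compose).  Casorati–Weierstrass (contrapositive) excludes an
essential singularity; a finite limit cannot lie in `U`. [cite: Conway1978, Ch. V Thm. 1.21 and Def. 1.3] -/
theorem end_trichotomy (hφ : φ ∈ holAut U) (hF : ∀ x : U, (φ x : ℂ) = F x) {l : Filter ℂ}
    (hl : l ∈ ({𝓝[≠] (0 : ℂ), 𝓝[≠] (1 : ℂ), cocompact ℂ} : Set (Filter ℂ))) :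
    ∃ l' ∈ ({𝓝[≠] (0 : ℂ), 𝓝[≠] (1 : ℂ), cocompact ℂ} : Set (Filter ℂ)), Tendsto F l l' := by
  obtain ⟨w, δ, hδ, hw⟩ := eventually_le_norm_sub hU hF hl
  have hd := eventually_differentiableAt hU hφ hF hl
  have hmemU : ∀ᶠ z in l, F z ∈ U :=
    (eventually_mem_of_mem_ends hU hl).mono fun z hz => apply_mem hF hz
  -- the dichotomy of `IsolatedSingularityDichotomy`, at a finite puncture or at `∞`
  have hdich : (∃ L : ℂ, Tendsto F l (𝓝 L)) ∨ Tendsto F l (cocompact ℂ) := by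
    rcases mem_ends_iff.mp hl with rfl | rfl | rfl
    · exact exists_tendsto_nhds_or_tendsto_cocompact_of_le_norm_sub hδ hd hw
    · exact exists_tendsto_nhds_or_tendsto_cocompact_of_le_norm_sub hδ hd hw
    · exact exists_tendsto_nhds_or_tendsto_cocompact_atInfty_of_le_norm_sub hδ hd hw
  rcases hdich with ⟨L, hL⟩ | hP
  · -- finite limit: `L ∈ {0, 1}`
    have hLU : L ∉ U := not_mem_of_tendsto_nhds hU hF hl hL
    have hL01 : L = 0 ∨ L = 1 := by
      rcases eq_or_ne L 0 with h0 | h0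
      · exact Or.inl h0
      rcases eq_or_ne L 1 with h1 | h1
      · exact Or.inr h1
      exact (hLU ((mem_iff hU).mpr ⟨h0, h1⟩)).elim
    have hne : ∀ᶠ z in l, F z ≠ L := hmemU.mono fun z hz h => hLU (h ▸ hz)
    have hL' : Tendsto F l (𝓝[≠] L) := tendsto_nhdsWithin_iff.mpr ⟨hL, hne⟩
    rcases hL01 with rfl | rfl
    · exact ⟨_, by simp, hL'⟩
    · exact ⟨_, by simp, hL'⟩
  · exact ⟨_, by simp, hP⟩

/-- The puncture `F` tends to along a (non-trivial) filter `l` is unique.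
[cite: Conway1978, Ch. V Def. 1.3] -/
theorem end_unique {l l₁ l₂ : Filter ℂ} [l.NeBot]
    (hl₁ : l₁ ∈ ({𝓝[≠] (0 : ℂ), 𝓝[≠] (1 : ℂ), cocompact ℂ} : Set (Filter ℂ)))
    (hl₂ : l₂ ∈ ({𝓝[≠] (0 : ℂ), 𝓝[≠] (1 : ℂ), cocompact ℂ} : Set (Filter ℂ)))
    (h₁ : Tendsto F l l₁) (h₂ : Tendsto F l l₂) : l₁ = l₂ := by
  by_contra hne
  have hd := disjoint_of_mem_ends_of_ne hl₁ hl₂ hne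
  have hle : map F l ≤ l₁ ⊓ l₂ := le_inf h₁ h₂
  rw [hd.eq_bot, le_bot_iff] at hle
  exact (map_neBot (f := l) (m := F)).ne hle

include hU in
/-- **Distinct punctures go to distinct punctures.**  If `F` tends to the same puncture along two
puncture filters `l₁, l₂`, then `l₁ = l₂` (apply the trichotomy to `φ⁻¹`, whose ambient representative
undoes `F` on `U`). [cite: Conway1978, Ch. V Thm. 1.21 and Def. 1.3] -/
theorem end_injective (hφ : φ ∈ holAut U) (hF : ∀ x : U, (φ x : ℂ) = F x) {l₁ l₂ l' : Filter ℂ}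
    (hl₁ : l₁ ∈ ({𝓝[≠] (0 : ℂ), 𝓝[≠] (1 : ℂ), cocompact ℂ} : Set (Filter ℂ)))
    (hl₂ : l₂ ∈ ({𝓝[≠] (0 : ℂ), 𝓝[≠] (1 : ℂ), cocompact ℂ} : Set (Filter ℂ)))
    (hl' : l' ∈ ({𝓝[≠] (0 : ℂ), 𝓝[≠] (1 : ℂ), cocompact ℂ} : Set (Filter ℂ)))
    (h₁ : Tendsto F l₁ l') (h₂ : Tendsto F l₂ l') : l₁ = l₂ := by
  classical
  -- ambient representative of `φ⁻¹`
  let F' : ℂ → ℂ := fun z => if h : z ∈ U then (φ.symm ⟨z, h⟩ : ℂ) else 0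
  have hF' : ∀ x : U, (φ.symm x : ℂ) = F' x := fun x => by
    simp only [F', dif_pos x.2]
  have hφ' : φ.symm ∈ holAut U := (holAut U).inv_mem hφ
  obtain ⟨l'', hl'', h''⟩ := end_trichotomy hU hφ' hF' hl'
  -- `F' ∘ F = id` along `l₁` and along `l₂`
  have key : ∀ {l : Filter ℂ}, l ∈ ({𝓝[≠] (0 : ℂ), 𝓝[≠] (1 : ℂ), cocompact ℂ} : Set (Filter ℂ)) →
      Tendsto F l l' → l = l'' := by
    intro l hl h
    have hc : Tendsto (F' ∘ F) l l'' := h''.comp h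
    have hid : Tendsto (fun z => z) l l'' := by
      refine hc.congr' ((eventually_mem_of_mem_ends hU hl).mono fun z hz => ?_)
      exact symm_apply_apply hF hF' hz
    exact eq_of_mem_ends_of_le hl hl'' (tendsto_id'.mp hid)
  exact (key hl₁ h₁).trans (key hl₂ h₂).symm

end Aut

end ThricePunctured

end Literature.Analysis.Complex

end
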